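import Literature.NumberTheory.Rogawski1990.Ch15Sec2
import Literature.NumberTheory.Rogawski1990.Ch12Sec3Bridge
import HarnessLib

/-!
# [Rogawski1990, §15.2 Prop. 15.2.1 (b), p. 249] BRIDGE: the `H¹`-case of the carpet's PROPOSITION 15.2.1 (`Ch15Sec2.caseB ∕ prop1521`) ↔ the tree's
# cohomological locus (`ArchSignRecipe.IsCohTrivial`, `Ch12Sec3Bridge.xiCaseOf ∕ exponentsOf`) and the one-dimensional `ξ` of §12.3 (`Ch12Sec3.XiCond ∕ piN`)

Topic `NumberTheory/Rogawski1990`; namespace `Literature.NumberTheory.Rogawski1990.Ch15Bridge`.  Squad TR «Rogawski U(3)» BRIDGE FILE (TR-plan RULING #11;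
DEAL 2026-09-02T02:36:17Z to LH1-p02, part (ii)).  Imports ★ files only (`Ch15Sec2` (TR-t10) → `Ch12Sec3Defs`; `Ch12Sec3Bridge` (LH1-p02) → `Ch12Sec3`,
`XiArchPinned`); THEOREMS ONLY (no definition, no new `Prop`-valued named fact, no `sorry`, no instance, no notation).

THE PRINT [Rogawski1990, §15.2 p. 249, chunk p0244]: PROPOSITION 15.2.1 — for `φ = φ(a,b,c)`, `a > b > c`, and an irreducible unitary `π` of `U_{2,1}(ℝ)`
with `H^*(𝔤, K, π ⊗ F_φ^*) ≠ 0`, one of (a) `π ∈ Π_φ` (cohomology in degree 2 only), (b) «`a − b = 1` and `π = J_φ⁻` or `b − c = 1` and `π = J_φ⁺`»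
(degrees 1 and 3), (c) `dim F_φ = 1`, `π = F_φ` (degrees 0, 2, 4).  CARPET ★ `Ch15Sec2` (TR-t10) types it as `prop1521 A X` over the §12.3 datum
`A : ArchPacketData CG CH CGt` and the posited cohomology numbers `X : CohData CG` (`X.h j π a b c = dim H^j(𝔤, K, π ⊗ F_φ^*)`).

WHAT THIS FILE PROVES (kernel arithmetic on the carpet's tables; the only input taken as a HYPOTHESIS is the carpet's own named fact `prop1521 A X`):
* §1 `h_one_eq_zero_of_caseA ∕ _of_caseC`, `h_one_eq_one_of_caseB`: in cases (a) and (c) `H¹ = 0`, in case (b) `H¹ = ℂ` — so **DEGREE ONE SINGLES OUT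
  CASE (b)**: `caseB_of_prop1521_of_h_one_ne_zero`.
* §2 case (b) IS «`π = πⁿ(ξ)` for a one-dimensional `ξ` with `Π(ξ) ↔ φ`» in the §12.3 vocabulary: `caseB_iff_exists_xiCase : caseB A X π a b c ↔
  (∃ s : XiCase, XiCond a b c s ∧ π = A.piN a b c s) ∧ ‹table›` (★ `Ch12Sec3Defs.XiCond ∕ piN`: label `0` = «`b − c = 1`, `J_φ⁺`», label `1` =
  «`a − b = 1`, `J_φ⁻`»); hence `exists_xiCase_of_h_one_ne_zero` (under `prop1521`).
* §3 TRIVIAL COEFFICIENTS `φ = φ(1,0,−1)` (`F_φ = 𝟙`; the locus of ★ `ArchSignRecipe.IsCohTrivial`): both side conditions hold, so case (b) is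
  `π ∈ {J⁺_{φ(1,0,−1)}, J⁻_{φ(1,0,−1)}}` = `{A.piN 1 0 (−1) s | s}`; through the exponents of ★ `Ch12Sec3Bridge`: `π = A.piN (rogTriple p q t) (xiCaseOf p t)`
  for a pair `(p, q)` with `IsCohTrivial p q t` — `exists_isCohTrivial_of_h_one_ne_zero` (under `prop1521`): **an irreducible unitary `π` with
  `H¹(𝔤, K; π) ≠ 0` is `πⁿ(ξ_ι)` for a one-dimensional `ξ_ι = (p, q; t)` on the cohomological locus** — the archimedean sentence the LH1 organ PIN-ι
  ([Prop. 15.2.1 (b) + §12.3 p. 178]) reads, at dictionary level.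
HONEST LABEL: HC_CM is proved only modulo the 7 printed citations (2 remaining: hLiu418 = stmt-HodgeConjecture-24832, h413 = stmt-HodgeConjecture-24833)
until rung 0 closes; this file asserts no new fact (`prop1521` enters as a hypothesis where used).

References: [Rogawski1990] J. D. Rogawski, *Automorphic Representations of Unitary Groups in Three Variables*, Ann. of Math. Stud. 123 (1990), §15.2
Prop. 15.2.1 p. 249 (chunk p0244); §12.3 p. 178 (chunk p0169: `πⁿ(ξ) = J_φ^±`, the one-dimensional `ξ`). [BorelWallach2000] VI Thm. 4.11 (the cited proof).
-/

namespace Literature.NumberTheory.Rogawski1990.Ch15Bridge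

open Ch12Sec3 Ch12Sec3Bridge Ch15Sec2 ArchSignRecipe

variable {CG CH CGt : Type*} (A : ArchPacketData CG CH CGt) (X : CohData CG)

/-! ## §1 Degree one singles out case (b) [Rogawski1990, Prop. 15.2.1 p. 249] -/

/-- In case (a) (`π ∈ Π_φ`) the cohomology is in degree `2` only: `H¹ = 0`. [cite: Rogawski1990, Prop. 15.2.1 (a) (p. 249, chunk p0244)] -/
theorem h_one_eq_zero_of_caseA {π : CG} {a b c : ℤ} (h : caseA A X π a b c) : X.h 1 π a b c = 0 := by
  rw [h.2 1]; rfl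

/-- In case (c) (`π = F_φ`, `dim F_φ = 1`) the cohomology is in degrees `0, 2, 4` only: `H¹ = 0`. [cite: Rogawski1990, Prop. 15.2.1 (c) (p. 249, chunk p0244)] -/
theorem h_one_eq_zero_of_caseC {π : CG} {a b c : ℤ} (h : caseC A X π a b c) : X.h 1 π a b c = 0 := by
  rw [h.2 1]; rfl

/-- In case (b) (`π = J_φ^±`) `H¹ = ℂ` (and `H³ = ℂ`). [cite: Rogawski1990, Prop. 15.2.1 (b) (p. 249, chunk p0244)] -/
theorem h_one_eq_one_of_caseB {π : CG} {a b c : ℤ} (h : caseB A X π a b c) : X.h 1 π a b c = 1 := by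
  rw [h.2 1]; rfl

/-- **`H¹ ≠ 0` ⇒ case (b)** (under the carpet's PROPOSITION 15.2.1): for `a > b > c` and `π` irreducible unitary with `dim H¹(𝔤, K, π ⊗ F_φ^*) ≠ 0`,
«`a − b = 1` and `π = J_φ⁻` or `b − c = 1` and `π = J_φ⁺`». [cite: Rogawski1990, Prop. 15.2.1 (b) (p. 249, chunk p0244)] -/
theorem caseB_of_prop1521_of_h_one_ne_zero (h15 : prop1521 A X) {a b c : ℤ} (hab : b < a) (hbc : c < b) (π : CG)
    (hu : A.IsUnitary π) (h1 : X.h 1 π a b c ≠ 0) : caseB A X π a b c := by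
  rcases h15 a b c hab hbc π hu ⟨1, h1⟩ with hA | hB | hC
  · exact absurd (h_one_eq_zero_of_caseA A X hA) h1
  · exact hB
  · exact absurd (h_one_eq_zero_of_caseC A X hC) h1

/-! ## §2 Case (b) in the §12.3 vocabulary: `π = πⁿ(ξ_s(a,b,c))` [Rogawski1990, §12.3 p. 178; Prop. 15.2.1 (b)] -/

/-- **Case (b) = «`π = πⁿ(ξ)` for a one-dimensional `ξ = ξ_s(a,b,c)`»**: the disjunction «`a − b = 1 ∧ π = J_φ⁻` or `b − c = 1 ∧ π = J_φ⁺`» is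
`∃ s : XiCase, XiCond a b c s ∧ π = A.piN a b c s` (label `1` ↦ the first disjunct, label `0` ↦ the second; ★ `Ch12Sec3Defs`).
[cite: Rogawski1990, Prop. 15.2.1 (b) (p. 249, chunk p0244); §12.3 (p. 178, chunk p0169)] -/
theorem caseB_iff_exists_xiCase (π : CG) (a b c : ℤ) :
    caseB A X π a b c ↔ (∃ s : XiCase, XiCond a b c s ∧ π = A.piN a b c s) ∧ ∀ j : ℕ, X.h j π a b c = if j = 1 ∨ j = 3 then 1 else 0 := by
  refine and_congr_left fun _ => ⟨?_, ?_⟩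
  · rintro (⟨hm, hπ⟩ | ⟨hn, hπ⟩)
    · exact ⟨1, (xiCond_one_iff a b c).2 hm, hπ⟩
    · exact ⟨0, (xiCond_zero_iff a b c).2 hn, hπ⟩
  · rintro ⟨s, hs, hπ⟩
    fin_cases s
    · exact Or.inr ⟨(xiCond_zero_iff a b c).1 hs, hπ⟩
    · exact Or.inl ⟨(xiCond_one_iff a b c).1 hs, hπ⟩

/-- **`H¹ ≠ 0` ⇒ `π = πⁿ(ξ_s(a,b,c))` for a label `s` whose side condition holds** (under `prop1521`), with the case-(b) table.
[cite: Rogawski1990, Prop. 15.2.1 (b) (p. 249, chunk p0244); §12.3 (p. 178, chunk p0169)] -/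
theorem exists_xiCase_of_h_one_ne_zero (h15 : prop1521 A X) {a b c : ℤ} (hab : b < a) (hbc : c < b) (π : CG)
    (hu : A.IsUnitary π) (h1 : X.h 1 π a b c ≠ 0) :
    (∃ s : XiCase, XiCond a b c s ∧ π = A.piN a b c s) ∧ ∀ j : ℕ, X.h j π a b c = if j = 1 ∨ j = 3 then 1 else 0 :=
  (caseB_iff_exists_xiCase A X π a b c).1 (caseB_of_prop1521_of_h_one_ne_zero A X h15 hab hbc π hu h1)

/-- Through the EXPONENTS (★ `Ch12Sec3Bridge.xiParamEquiv`): `H¹ ≠ 0` ⇒ `π = A.piN (rogTriple p q t) (xiCaseOf p t)` for the pair `(p, q) = exponentsOf t a b c s`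
(the printed `ξ(h) = det₀^p det^q`), whose triple is `(a, b, c)` again. [cite: Rogawski1990, Prop. 15.2.1 (b) (p. 249, chunk p0244); §12.3 (p. 178, chunk p0169)] -/
theorem exists_exponents_of_h_one_ne_zero (h15 : prop1521 A X) {a b c : ℤ} (hab : b < a) (hbc : c < b) (π : CG)
    (hu : A.IsUnitary π) (h1 : X.h 1 π a b c ≠ 0) (t : ℤ) :
    ∃ p q : ℤ, rogTriple p q t = (a, b, c) ∧
      π = A.piN (rogTriple p q t).1 (rogTriple p q t).2.1 (rogTriple p q t).2.2 (xiCaseOf p t) := by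
  obtain ⟨⟨s, hs, hπ⟩, -⟩ := exists_xiCase_of_h_one_ne_zero A X h15 hab hbc π hu h1
  refine ⟨(exponentsOf t a b c s).1, (exponentsOf t a b c s).2, rogTriple_exponentsOf hab.le hbc.le hs t, ?_⟩
  rw [rogTriple_exponentsOf hab.le hbc.le hs t, xiCaseOf_exponentsOf hab.le hbc.le hs t]
  exact hπ

/-! ## §3 Trivial coefficients `φ = φ(1,0,−1)`: the cohomological locus [Rogawski1990, Prop. 15.2.1 (b); §12.3 p. 178] -/

/-- **At `φ(1,0,−1)` case (b) is `π ∈ {J⁺, J⁻}` with no side condition left** (`1 − 0 = 1 = 0 − (−1)`): `caseB A X π 1 0 (−1) ↔ (∃ s, π = A.piN 1 0 (−1) s) ∧ ‹table›`.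
[cite: Rogawski1990, Prop. 15.2.1 (b) (p. 249, chunk p0244); §12.3 (p. 178, chunk p0169)] -/
theorem caseB_coh_iff (π : CG) :
    caseB A X π 1 0 (-1) ↔ (∃ s : XiCase, π = A.piN 1 0 (-1) s) ∧ ∀ j : ℕ, X.h j π 1 0 (-1) = if j = 1 ∨ j = 3 then 1 else 0 := by
  rw [caseB_iff_exists_xiCase]
  exact and_congr_left fun _ => ⟨fun ⟨s, _, hπ⟩ => ⟨s, hπ⟩, fun ⟨s, hπ⟩ => ⟨s, xiCond_coh s, hπ⟩⟩

/-- **THE `H¹`-SENTENCE AT TRIVIAL COEFFICIENTS, through exponents** (under `prop1521`): an irreducible unitary `π` of `U(2,1)` with `H¹(𝔤, K; π) ≠ 0`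
(`X.h 1 π 1 0 (−1) ≠ 0`) is `πⁿ(ξ_ι)` for a one-dimensional `ξ_ι = (p, q; t)` ON THE COHOMOLOGICAL LOCUS ★ `IsCohTrivial p q t` — for every parameter `t` of `μ`:
`∃ p q, IsCohTrivial p q t ∧ π = A.piN 1 0 (−1) (xiCaseOf p t)`; and `H¹ = H³ = ℂ`. [cite: Rogawski1990, Prop. 15.2.1 (b) (p. 249, chunk p0244); §12.3 (p. 178, chunk p0169)] -/
theorem exists_isCohTrivial_of_h_one_ne_zero (h15 : prop1521 A X) (π : CG) (hu : A.IsUnitary π) (h1 : X.h 1 π 1 0 (-1) ≠ 0) (t : ℤ) :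
    (∃ p q : ℤ, IsCohTrivial p q t ∧ π = A.piN 1 0 (-1) (xiCaseOf p t)) ∧ ∀ j : ℕ, X.h j π 1 0 (-1) = if j = 1 ∨ j = 3 then 1 else 0 := by
  obtain ⟨⟨s, hs, hπ⟩, htab⟩ := exists_xiCase_of_h_one_ne_zero A X h15 (by norm_num) (by norm_num) π hu h1
  refine ⟨⟨(exponentsOf t 1 0 (-1) s).1, (exponentsOf t 1 0 (-1) s).2, isCohTrivial_exponentsOf_coh t s, ?_⟩, htab⟩
  rw [xiCaseOf_exponentsOf (by norm_num) (by norm_num) hs t]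
  exact hπ

/-- … equivalently with the sign read off `q`: `π = J⁺_{φ(1,0,−1)}` if `q = 1`, `J⁻_{φ(1,0,−1)}` if `q = −1` (★ `Ch12Sec3Bridge.piN_coh_of_isCohTrivial`; `q = ±1` by
★ `q_eq_one_or_eq_neg_one_of_isCohTrivial`). [cite: Rogawski1990, Prop. 15.2.1 (b) (p. 249, chunk p0244); §12.3 (p. 178, chunk p0169)] -/
theorem exists_isCohTrivial_of_h_one_ne_zero' (h15 : prop1521 A X) (π : CG) (hu : A.IsUnitary π) (h1 : X.h 1 π 1 0 (-1) ≠ 0) (t : ℤ) :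
    ∃ p q : ℤ, IsCohTrivial p q t ∧ (q = 1 ∨ q = -1) ∧ π = if q = 1 then A.Jp 1 0 (-1) else A.Jm 1 0 (-1) := by
  obtain ⟨⟨p, q, hcoh, hπ⟩, -⟩ := exists_isCohTrivial_of_h_one_ne_zero A X h15 π hu h1 t
  exact ⟨p, q, hcoh, q_eq_one_or_eq_neg_one_of_isCohTrivial hcoh, hπ.trans (piN_coh_of_isCohTrivial A hcoh)⟩

/-- The CM dress: for a one-dimensional automorphic `ξ` of `H` over a CM field and an embedding `ι` (★ `OneDimAutRepH`), «`πⁿ(ξ_ι)` is in case (b) at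
`φ(1,0,−1)`» holds exactly when `ξ.IsCohTrivialAt t ι`: then `A.piN 1 0 (−1) (xiCaseOf (ξ.pη ι) t)` is `J⁺` or `J⁻` according to `ξ.qψ ι = ±1`.
[cite: Rogawski1990, Prop. 15.2.1 (b) (p. 249, chunk p0244); §12.3 (p. 178, chunk p0169)] -/
theorem piN_coh_of_isCohTrivialAt {L : Type} [Field L] [NumberField L] [NumberField.IsCMField L] (ξ : OneDimAutRepH L) {t : ℤ} {ι : L →+* ℂ}
    (h : ξ.IsCohTrivialAt t ι) :
    A.piN 1 0 (-1) (xiCaseOf (ξ.pη ι) t) = if ξ.qψ ι = 1 then A.Jp 1 0 (-1) else A.Jm 1 0 (-1) :=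
  piN_coh_of_isCohTrivial A h

end Literature.NumberTheory.Rogawski1990.Ch15Bridge
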